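import Literature.MathematicalPhysics.QuantumManyBody.LiebYngvasonCellMethod
import HarnessLib

/-!
# Route `BECHeatBathGap`, crux `SquareSummableInfluence` (stmt-AtomisticToContinuum-14368),
# line `registered`: the registered stub `stub_influenceLipschitzState`

Supports (does not close) stmt-AtomisticToContinuum-14368; stub `stub_influenceLipschitzState` of
line `registered` (skeleton v2).

**The influence sum is `L²`-Lipschitz in the `(N+1)`-body state.** For measurable
`Ψ, Ψ' : Λ^{N+1} → ℂ` and measurable predictors `h_i : Λ^{N+1} → ℂ`:

`∑_i ∫_{Λ_L^{N+1}} |Ψ − h_i|² ≤ 2 ∑_i ∫_{Λ_L^{N+1}} |Ψ' − h_i|² + 2 N ∫ |Ψ − Ψ'|²`.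

## Proof

Pointwise `Ψ − h_i = (Ψ' − h_i) + (Ψ − Ψ')`, so `|Ψ − h_i|² ≤ 2|Ψ' − h_i|² + 2|Ψ − Ψ'|²`
(`|a + b|² ≤ 2|a|² + 2|b|²`). Integrate over the box `Λ_L^{N+1}` (monotonicity and linearity of the
restricted lower Lebesgue integral), bound the restricted integral of `|Ψ − Ψ'|²` by the unrestricted
one, and sum the `N` identical second terms.

No new definitions; `[folklore]`.
-/

noncomputable section

open MeasureTheory Filter
open scoped ENNReal NNReal

namespace Summit.AtomisticToContinuum.BoseEinsteinCondensation.Theorems.SquareSummableInfluence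

open Literature.MathematicalPhysics.QuantumManyBody.BoseGas

/-! ### Bookkeeping lemmas -/

/-- `|a + b|² ≤ 2|a|² + 2|b|²` for complex numbers, in `ℝ≥0∞`. [folklore] -/
private theorem coe_nnnorm_add_sq_le_two_mul_state (a b : ℂ) :
    (‖a + b‖₊ : ℝ≥0∞) ^ 2 ≤ 2 * (‖a‖₊ : ℝ≥0∞) ^ 2 + 2 * (‖b‖₊ : ℝ≥0∞) ^ 2 := by
  have h : ‖a + b‖₊ ^ 2 ≤ 2 * ‖a‖₊ ^ 2 + 2 * ‖b‖₊ ^ 2 := by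
    rw [← NNReal.coe_le_coe]
    push_cast
    have h1 : ‖a + b‖ ≤ ‖a‖ + ‖b‖ := norm_add_le a b
    have h2 : ‖a + b‖ ^ 2 ≤ (‖a‖ + ‖b‖) ^ 2 := by
      have h0 : 0 ≤ ‖a + b‖ := norm_nonneg _
      nlinarith [h1, h0]
    nlinarith [h2, sq_nonneg (‖a‖ - ‖b‖)]
  exact_mod_cast h

/-- **One term of the influence sum**: for measurable `Ψ, Ψ', g : Λ^{N+1} → ℂ`,
`∫_{Λ_L^{N+1}} |Ψ − g|² ≤ 2 ∫_{Λ_L^{N+1}} |Ψ' − g|² + 2 ∫ |Ψ − Ψ'|²`. [folklore] -/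
private theorem influence_state_term_bound (N : ℕ) (L : ℝ) (Ψ Ψ' g : Config (N + 1) → ℂ)
    (hΨ : Measurable Ψ) (hΨ' : Measurable Ψ') (hg : Measurable g) :
    ∫⁻ Z in boxN (N + 1) L, (‖Ψ Z - g Z‖₊ : ℝ≥0∞) ^ 2 ≤
      2 * (∫⁻ Z in boxN (N + 1) L, (‖Ψ' Z - g Z‖₊ : ℝ≥0∞) ^ 2) +
        2 * ∫⁻ Z, (‖Ψ Z - Ψ' Z‖₊ : ℝ≥0∞) ^ 2 := by
  -- measurability bookkeeping
  have hA : Measurable fun Z : Config (N + 1) => (‖Ψ' Z - g Z‖₊ : ℝ≥0∞) ^ 2 :=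
    (hΨ'.sub hg).nnnorm.coe_nnreal_ennreal.pow_const 2
  have hA2 : Measurable fun Z : Config (N + 1) => 2 * (‖Ψ' Z - g Z‖₊ : ℝ≥0∞) ^ 2 :=
    hA.const_mul 2
  have hB : Measurable fun Z : Config (N + 1) => (‖Ψ Z - Ψ' Z‖₊ : ℝ≥0∞) ^ 2 :=
    (hΨ.sub hΨ').nnnorm.coe_nnreal_ennreal.pow_const 2
  -- the pointwise step
  have hpt : ∀ Z : Config (N + 1), (‖Ψ Z - g Z‖₊ : ℝ≥0∞) ^ 2 ≤
      2 * (‖Ψ' Z - g Z‖₊ : ℝ≥0∞) ^ 2 + 2 * (‖Ψ Z - Ψ' Z‖₊ : ℝ≥0∞) ^ 2 := by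
    intro Z
    have e : Ψ Z - g Z = (Ψ' Z - g Z) + (Ψ Z - Ψ' Z) := by ring
    rw [e]
    exact coe_nnnorm_add_sq_le_two_mul_state _ _
  calc ∫⁻ Z in boxN (N + 1) L, (‖Ψ Z - g Z‖₊ : ℝ≥0∞) ^ 2
      ≤ ∫⁻ Z in boxN (N + 1) L,
          (2 * (‖Ψ' Z - g Z‖₊ : ℝ≥0∞) ^ 2 + 2 * (‖Ψ Z - Ψ' Z‖₊ : ℝ≥0∞) ^ 2) :=
        lintegral_mono fun Z => hpt Z
    _ = 2 * (∫⁻ Z in boxN (N + 1) L, (‖Ψ' Z - g Z‖₊ : ℝ≥0∞) ^ 2) +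
          2 * ∫⁻ Z in boxN (N + 1) L, (‖Ψ Z - Ψ' Z‖₊ : ℝ≥0∞) ^ 2 := by
        rw [lintegral_add_left hA2, lintegral_const_mul _ hA, lintegral_const_mul _ hB]
    _ ≤ 2 * (∫⁻ Z in boxN (N + 1) L, (‖Ψ' Z - g Z‖₊ : ℝ≥0∞) ^ 2) +
          2 * ∫⁻ Z, (‖Ψ Z - Ψ' Z‖₊ : ℝ≥0∞) ^ 2 :=
        add_le_add le_rfl (mul_le_mul' le_rfl (setLIntegral_le_lintegral _ _))

/-! ### The stub -/

/-- **Stub 4 (S, frame) of line `registered` (skeleton v2) of the crux `SquareSummableInfluence`: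
the influence sum is `L²`-Lipschitz in the `(N+1)`-body state.** For measurable
`Ψ, Ψ' : Λ^{N+1} → ℂ` and measurable `h_i`:
`∑_i ∫_{Λ_L^{N+1}} |Ψ − h_i|² ≤ 2 ∑_i ∫_{Λ_L^{N+1}} |Ψ' − h_i|² + 2 N ∫ |Ψ − Ψ'|²`
(pointwise `|a+b|² ≤ 2|a|²+2|b|²`, monotonicity of the restricted integral, `N` equal terms).
[folklore] -/
theorem stub_influenceLipschitzState :
    ∀ (N : ℕ) (L : ℝ) (Ψ Ψ' : Config (N + 1) → ℂ) (h : Fin N → Config (N + 1) → ℂ),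
      Measurable Ψ → Measurable Ψ' → (∀ i, Measurable (h i)) →
        (∑ i : Fin N, ∫⁻ Z in boxN (N + 1) L, (‖Ψ Z - h i Z‖₊ : ℝ≥0∞) ^ 2) ≤
          2 * (∑ i : Fin N, ∫⁻ Z in boxN (N + 1) L, (‖Ψ' Z - h i Z‖₊ : ℝ≥0∞) ^ 2) +
            2 * (N : ℝ≥0∞) * ∫⁻ Z, (‖Ψ Z - Ψ' Z‖₊ : ℝ≥0∞) ^ 2 := by
  intro N L Ψ Ψ' h hΨ hΨ' hh
  calc (∑ i : Fin N, ∫⁻ Z in boxN (N + 1) L, (‖Ψ Z - h i Z‖₊ : ℝ≥0∞) ^ 2)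
      ≤ ∑ i : Fin N, (2 * (∫⁻ Z in boxN (N + 1) L, (‖Ψ' Z - h i Z‖₊ : ℝ≥0∞) ^ 2) +
          2 * ∫⁻ Z, (‖Ψ Z - Ψ' Z‖₊ : ℝ≥0∞) ^ 2) :=
        Finset.sum_le_sum fun i _ =>
          influence_state_term_bound N L Ψ Ψ' (h i) hΨ hΨ' (hh i)
    _ = 2 * (∑ i : Fin N, ∫⁻ Z in boxN (N + 1) L, (‖Ψ' Z - h i Z‖₊ : ℝ≥0∞) ^ 2) +
          (N : ℝ≥0∞) * (2 * ∫⁻ Z, (‖Ψ Z - Ψ' Z‖₊ : ℝ≥0∞) ^ 2) := by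
        rw [Finset.sum_add_distrib, ← Finset.mul_sum, Finset.sum_const, Finset.card_univ,
          Fintype.card_fin, nsmul_eq_mul]
    _ = _ := by ring

end Summit.AtomisticToContinuum.BoseEinsteinCondensation.Theorems.SquareSummableInfluence
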